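import Literature.AlgebraicGeometry.Deligne1982.WeilTypeCMFieldIsCM
import Literature.AlgebraicGeometry.HodgeTheory.WeilClassesCMReductionSplit
import Literature.NumberTheory.QuadraticForms.HilbertSymbolPlaces
import Literature.NumberTheory.Automorphic.QuaternionRamificationParityHolds
import Summits.HodgeConjecture.HodgeConjecture.Theorems.Ring2WeilCoverageCMFieldZeta5
import HarnessLib

/-!
# Ring 2 — Weil-family coverage, CM-field rows: the CLOSED FORM of the row index `δ` — the norm residue
  group `F^×/Nm_{E/F}(E^×)` of Deligne's carriers IS the group of Hilbert-symbol patterns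
  (WEIL-FAMILY-COVERAGE «## b03», open cell (ix′))

research route conditional on HC_CM; not a corollary; Q11.4-sentence-2 already refuted in dim ≥ 3.

The components `W_{2k}.E.δ` of the Weil family over a CM field `E = ℚ[T]/(R(T²))` with totally real
subfield `F = ℚ[S]/(R) = ℚ(θ)`, `θ = η²` the class of `S` (so `E = F(√θ)`, `θ` totally negative), are indexed
by Deligne's discriminant `δ ∈ F^×/Nm_{E/F}(E^×) = cmNormResidueGroup R` [cite: Deligne1982HodgeCycles, §4:
display (1) and Cor. 4.2 — p. 28 of the re-edition of LNM 900]; Deligne (after Landherr) notes that this group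
is described by LOCAL invariants.  The census `HOME/WEIL-FAMILY-COVERAGE.md` §b03.5 accordingly labels every
row by the finite EVEN set `T(δ)` of places of `F` at which the local norm residue symbol `(δ, θ)_v` is `-1`,
computed there by PARI (tier C).  THIS FILE makes that labelling a KERNEL THEOREM for EVERY carrier `R`, by
assembling the tree's (fully proved) arithmetic of quadratic extensions of number fields
(`Literature/NumberTheory/QuadraticForms`: O'Meara §63B 63:10, Hasse's norm theorem 65:23, Hilbert's
reciprocity law 71:18, O'Meara 71:19 — `hilbertSymbol_eq_one_of_forall_completions_holds`,
`hilbertReciprocity_holds`, `exists_hilbertSymbol_eq_neg_one_iff_of_hilbertReciprocity`) on Deligne's carriers: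

* §1 `normUnitsSubgroup_eq_quadraticNormSubgroup`: `Nm_{E/F}(E^×) = {x² - θy²} = quadraticNormSubgroup F θ`
  (`Nm(ιa + ιb·η) = a² - θb²`); `θ` is a non-square of `F`.
* §2 `mk_eq_mk_iff_hilbertSymbol_eq_one`: `[q] = [q'] ⟺ (q⁻¹q', θ)_F = 1` (O'Meara 63:10).
* §3 LOCAL–GLOBAL `mk_eq_mk_iff_forall_placeSymbol_eq_one`: `[q] = [q'] ⟺ (q⁻¹q', θ)_𝔭 = 1` at EVERY place
  `𝔭` of `F`, finite or infinite (Hasse 65:23 on the carriers), i.e. `⟺ badPlaces (q⁻¹q') θ = ∅`;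
  hence `mk_eq_mk_iff_badPlaces_eq`: **`[q] = [q'] ⟺ T(q) = T(q')`** with `T(q) = badPlaces q θ` the finite set
  of places where `(q, θ)_𝔭 = -1` — the row index IS the `T`-set.
The sequel `Ring2WeilCoverageCMFieldNormResidueSymbolsPlaces` adds: the infinite places (`(q, θ)_w = 1 ⟺ q >_w 0`,
so polarized rows — `δ ≫ 0` — are labelled by finite places only), `|T(q)|` EVEN (Hilbert reciprocity 71:18),
`T(q) ⊆` non-split places, and the realisation of EVERY finite even set of non-split finite places as a `T(q)`,
`q ≫ 0` (O'Meara 71:19); `Ring2WeilCoverageCMFieldNormResidueSymbolsLocal` the closed form of `(q, θ)_v` at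
`v ∤ 2θ` (inert: valuation parity; split: `+1`).  No new definition, no named fact, no sorry.
-/

noncomputable section

set_option linter.dupNamespace false

open Polynomial NumberField IsDedekindDomain

namespace Summit.HodgeConjecture.HodgeConjecture.Ring2.WeilCoverageCM

open Literature.AlgebraicGeometry.Deligne1982
open Literature.AlgebraicGeometry.HodgeTheory (splitDiscriminantClassCM)
open Literature.AlgebraicGeometry.Motives (normUnitsSubgroup mem_normUnitsSubgroup_iff)
open Literature.NumberTheory.QuadraticForms

variable {R : Polynomial ℤ} [Fact (Irreducible (cmPolyQ R))] [Fact (Irreducible (realPolyQ R))]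

/-! ### §1 The norm form of `E/F` and the norm subgroup -/

/-- **`Nm_{E/F}(ιa + ιb·η) = a² - θb²`** (`η̄ = -η`, `η² = ιθ`, `θ` = the class of `S` in `F = ℚ[S]/(R)`).
[cite: Deligne1982HodgeCycles, §4 p. 30] -/
theorem norm_realToCM_add_mul_cmRoot (a b : realField R) :
    Algebra.norm (realField R) (realToCM R a + realToCM R b * cmRoot R) =
      a ^ 2 - AdjoinRoot.root (realPolyQ R) * b ^ 2 := by
  apply (algebraMap (realField R) (cmField R)).injective
  rw [algebraMap_norm_eq_mul_cmConj, norm_coords, algebraMap_realField_eq]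

/-- **`Nm_{E/F}(E^×) = {x² - θy² ≠ 0}`**: on Deligne's carriers the norm subgroup of `E = F(η)`, `η² = θ`, is the
tree's `quadraticNormSubgroup F θ` of the quadratic extension `F(√θ)` (every `z ∈ E` is `ιa + ιb·η`).
[cite: Deligne1982HodgeCycles, §4 p. 30] [cite: Omeara1963, §65A (local norms)] -/
theorem normUnitsSubgroup_eq_quadraticNormSubgroup :
    normUnitsSubgroup (realField R) (cmField R) =
      quadraticNormSubgroup (realField R) (AdjoinRoot.root (realPolyQ R)) := by
  ext t
  rw [mem_normUnitsSubgroup_iff, mem_quadraticNormSubgroup_iff]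
  constructor
  · rintro ⟨z, hz⟩
    obtain ⟨a, b, hab⟩ := exists_eq_realToCM_add_mul_cmRoot R (z : cmField R)
    exact ⟨a, b, by rw [← hz, hab, norm_realToCM_add_mul_cmRoot]⟩
  · rintro ⟨x, y, hxy⟩
    have hz0 : realToCM R x + realToCM R y * cmRoot R ≠ 0 := by
      intro h0
      have h1 : Algebra.norm (realField R) (realToCM R x + realToCM R y * cmRoot R) = 0 := by
        rw [h0, Algebra.norm_zero]
      rw [norm_realToCM_add_mul_cmRoot, hxy] at h1
      exact t.ne_zero h1
    exact ⟨Units.mk0 _ hz0, by rw [Units.val_mk0, norm_realToCM_add_mul_cmRoot, hxy]⟩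

omit [Fact (Irreducible (cmPolyQ R))] in
/-- `deg R(T²) ≥ 2`. [cite: Deligne1982HodgeCycles, §4 p. 30] -/
theorem two_le_natDegree_cmPolyQ : 2 ≤ (cmPolyQ R).natDegree := by
  have hirr : Irreducible (realPolyQ R) := Fact.out
  have h := Polynomial.natDegree_pos_iff_degree_pos.2 (Polynomial.degree_pos_of_irreducible hirr)
  rw [realPolyQ, Polynomial.natDegree_map_eq_of_injective (Int.castRingHom ℚ).injective_int] at h
  rw [cmPolyQ, Polynomial.natDegree_map_eq_of_injective (Int.castRingHom ℚ).injective_int,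
    Polynomial.natDegree_comp, Polynomial.natDegree_X_pow]
  omega

/-- **`θ = η²` is NOT a square in `F`** (`θ = c²` would give `η = ±ιc`, fixed by conjugation, against
`η̄ = -η ≠ 0`): `E = F(√θ)` is a genuine quadratic extension. [cite: Deligne1982HodgeCycles, §4 p. 30] -/
theorem not_isSquare_root_realPolyQ : ¬ IsSquare (AdjoinRoot.root (realPolyQ R)) := by
  rintro ⟨c, hc⟩
  have hη : (cmRoot R - realToCM R c) * (cmRoot R + realToCM R c) = 0 := by
    have h1 : cmRoot R ^ 2 = realToCM R c * realToCM R c := by rw [← map_mul, ← hc, realToCM_root]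
    linear_combination h1
  have hne := cmRoot_ne_zero R two_le_natDegree_cmPolyQ
  rcases mul_eq_zero.1 hη with h | h
  · have h2 : cmRoot R = realToCM R c := sub_eq_zero.1 h
    have h3 := cmConj_cmRoot R
    rw [h2, cmConj_realToCM, ← h2] at h3
    exact hne (CharZero.eq_neg_self_iff.1 h3)
  · have h2 : realToCM R c = -cmRoot R := (neg_eq_of_add_eq_zero_right h).symm
    have h3 : cmConj R (realToCM R c) = realToCM R c := cmConj_realToCM R c
    rw [h2, map_neg, cmConj_cmRoot, neg_neg] at h3
    exact hne (CharZero.eq_neg_self_iff.1 h3)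

/-- `θ ≠ 0` in `F`. [cite: Deligne1982HodgeCycles, §4 p. 30] -/
theorem root_realPolyQ_ne_zero : AdjoinRoot.root (realPolyQ R) ≠ 0 := fun h ↦
  not_isSquare_root_realPolyQ (R := R) (by rw [h]; exact IsSquare.zero)

/-! ### §2 Classes and the global Hilbert symbol `( · , θ)_F` (O'Meara 63:10) -/

/-- **`[q] = [q']` in `F^×/Nm_{E/F}(E^×)` iff `q⁻¹q' = x² - θy²`** for some `x, y ∈ F`.
[cite: Deligne1982HodgeCycles, §4 p. 30] -/
theorem mk_eq_mk_iff_mem_quadraticNormSubgroup (q q' : (realField R)ˣ) :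
    (QuotientGroup.mk q : cmNormResidueGroup R) = QuotientGroup.mk q' ↔
      q⁻¹ * q' ∈ quadraticNormSubgroup (realField R) (AdjoinRoot.root (realPolyQ R)) := by
  rw [QuotientGroup.eq, normUnitsSubgroup_eq_quadraticNormSubgroup]

/-- **`[q] = [q']` iff the Hilbert symbol `(q⁻¹q', θ)_F` is `1`** (O'Meara 63:10: `(t, θ) = 1` iff `t` is a norm
from `F(√θ) = E`). [cite: Omeara1963, §63B 63:10] [cite: Deligne1982HodgeCycles, §4 (1)] -/
theorem mk_eq_mk_iff_hilbertSymbol_eq_one (q q' : (realField R)ˣ) :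
    (QuotientGroup.mk q : cmNormResidueGroup R) = QuotientGroup.mk q' ↔
      hilbertSymbol (realField R) ((q⁻¹ * q' : (realField R)ˣ) : realField R) (AdjoinRoot.root (realPolyQ R)) = 1 := by
  haveI : NeZero (2 : realField R) := ⟨two_ne_zero⟩
  rw [mk_eq_mk_iff_mem_quadraticNormSubgroup,
    hilbertSymbol_eq_one_iff_mem_quadraticNormSubgroup root_realPolyQ_ne_zero]

/-- **Split rows**: `[q]` is the split class `[(-1)^k]` of `E`-rank `2k` iff `((-1)^k q, θ)_F = 1`.
[cite: Deligne1982HodgeCycles, §4 Cor. 4.2] [cite: Omeara1963, §63B 63:10] -/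
theorem mk_eq_splitDiscriminantClassCM_iff_hilbertSymbol_eq_one (q : (realField R)ˣ) (k : ℕ) :
    (QuotientGroup.mk q : cmNormResidueGroup R) = splitDiscriminantClassCM R k ↔
      hilbertSymbol (realField R) ((-1) ^ k * (q : realField R)) (AdjoinRoot.root (realPolyQ R)) = 1 := by
  rw [splitDiscriminantClassCM, eq_comm, mk_eq_mk_iff_hilbertSymbol_eq_one]
  have h : ((((-1 : (realField R)ˣ) ^ k)⁻¹ * q : (realField R)ˣ) : realField R) =
      (-1) ^ k * (q : realField R) := by
    rw [Units.val_mul, Units.val_inv_eq_inv_val, Units.val_pow_eq_pow_val, Units.val_neg, Units.val_one,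
      ← inv_pow, inv_neg_one]
  rw [h]

/-! ### §3 Local–global: the class of `q` is the pattern of its local symbols (Hasse 65:23) -/

/-- **LOCAL–GLOBAL PRINCIPLE for the global symbol** (Hasse's norm theorem 65:23 on the carriers, with its
trivial converse): for `t ∈ F^×`, `(t, θ)_F = 1` iff `(t, θ)_v = 1` at every finite place AND `(t, θ)_w = 1` at
every infinite place of `F`. [cite: Omeara1963, §65D Thm. 65:23] [cite: VignerasLNM800, Ch. III §3 Cor. 3.4] -/
theorem hilbertSymbol_root_eq_one_iff_forall {t : realField R} (ht : t ≠ 0) :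
    hilbertSymbol (realField R) t (AdjoinRoot.root (realPolyQ R)) = 1 ↔
      (∀ v : HeightOneSpectrum (𝓞 (realField R)),
          hilbertSymbol (v.adicCompletion (realField R)) (algebraMap (realField R) _ t)
            (algebraMap (realField R) _ (AdjoinRoot.root (realPolyQ R))) = 1) ∧
        ∀ w : InfinitePlace (realField R),
          hilbertSymbol w.Completion (algebraMap (realField R) _ t)
            (algebraMap (realField R) _ (AdjoinRoot.root (realPolyQ R))) = 1 := by
  constructor
  · intro h
    exact ⟨fun v ↦ Literature.NumberTheory.Automorphic.hilbertSymbol_map_eq_one _ h,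
      fun w ↦ Literature.NumberTheory.Automorphic.hilbertSymbol_map_eq_one _ h⟩
  · rintro ⟨hfin, hinf⟩
    rw [hilbertSymbol_comm]
    refine Literature.NumberTheory.Automorphic.hilbertSymbol_eq_one_of_forall_completions_holds (realField R)
      (AdjoinRoot.root (realPolyQ R)) t not_isSquare_root_realPolyQ ht (fun v ↦ ?_) (fun w ↦ ?_)
    · rw [hilbertSymbol_comm]; exact hfin v
    · rw [hilbertSymbol_comm]; exact hinf w

/-- The same in the language of places `𝔭 ∈ HeightOneSpectrum (𝓞 F) ⊕ InfinitePlace F`: `(t, θ)_F = 1` iff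
`placeSymbol t θ 𝔭 = 1` for every place `𝔭`, iff `badPlaces t θ = ∅`. [cite: Omeara1963, §65D Thm. 65:23] -/
theorem hilbertSymbol_root_eq_one_iff_badPlaces_eq_empty {t : realField R} (ht : t ≠ 0) :
    hilbertSymbol (realField R) t (AdjoinRoot.root (realPolyQ R)) = 1 ↔
      badPlaces t (AdjoinRoot.root (realPolyQ R)) = ∅ := by
  rw [hilbertSymbol_root_eq_one_iff_forall ht, Set.eq_empty_iff_forall_notMem]
  constructor
  · rintro ⟨hfin, hinf⟩ p hp
    rw [mem_badPlaces_iff] at hp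
    cases p with
    | inl v => rw [placeSymbol_inl, hfin v] at hp; norm_num at hp
    | inr w => rw [placeSymbol_inr, hinf w] at hp; norm_num at hp
  · intro h
    refine ⟨fun v ↦ ?_, fun w ↦ ?_⟩
    · have hv := h (Sum.inl v)
      rw [mem_badPlaces_iff, ← placeSymbol_ne_one_iff, not_not, placeSymbol_inl] at hv
      exact hv
    · have hw := h (Sum.inr w)
      rw [mem_badPlaces_iff, ← placeSymbol_ne_one_iff, not_not, placeSymbol_inr] at hw
      exact hw

/-- **`[q] = [q']` iff `(q⁻¹q', θ)_𝔭 = 1` at every place `𝔭` of `F`** (finite and infinite): two Weil-type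
discriminants define the same component iff their quotient is a LOCAL norm from `E` everywhere — Landherr's
theorem for the rank-one hermitian space `⟨δ⟩`, in Hasse's form. [cite: Deligne1982HodgeCycles, §4 Prop. 4.1 and (1)]
[cite: Landherr1936HermitianForms] [cite: Omeara1963, §65D Thm. 65:23] -/
theorem mk_eq_mk_iff_forall_placeSymbol_eq_one (q q' : (realField R)ˣ) :
    (QuotientGroup.mk q : cmNormResidueGroup R) = QuotientGroup.mk q' ↔
      ∀ p : HeightOneSpectrum (𝓞 (realField R)) ⊕ InfinitePlace (realField R),
        placeSymbol ((q⁻¹ * q' : (realField R)ˣ) : realField R) (AdjoinRoot.root (realPolyQ R)) p = 1 := by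
  rw [mk_eq_mk_iff_hilbertSymbol_eq_one, hilbertSymbol_root_eq_one_iff_badPlaces_eq_empty (Units.ne_zero _),
    Set.eq_empty_iff_forall_notMem]
  refine forall_congr' fun p ↦ ?_
  rw [mem_badPlaces_iff, ← placeSymbol_ne_one_iff, not_not]

/-- `T(q⁻¹) = T(q)`: the local symbols of `q⁻¹ = q · (q⁻¹)²` and `q` agree (values `±1`, multiplicative).
[cite: Omeara1963, §63B (formulas after 63:10)] -/
theorem badPlaces_inv (q : (realField R)ˣ) :
    badPlaces ((q⁻¹ : (realField R)ˣ) : realField R) (AdjoinRoot.root (realPolyQ R)) =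
      badPlaces (q : realField R) (AdjoinRoot.root (realPolyQ R)) := by
  ext p
  rw [mem_badPlaces_iff, mem_badPlaces_iff]
  have hmul := placeSymbol_mul_left (x := ((q⁻¹ : (realField R)ˣ) : realField R)) (y := (q : realField R))
    (b := AdjoinRoot.root (realPolyQ R)) (Units.ne_zero _) (Units.ne_zero _) root_realPolyQ_ne_zero p
  have h1 : placeSymbol (1 : realField R) (AdjoinRoot.root (realPolyQ R)) p = 1 := by
    cases p with
    | inl v => rw [placeSymbol_inl, map_one, hilbertSymbol_one_left]
    | inr w => rw [placeSymbol_inr, map_one, hilbertSymbol_one_left]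
  rw [Units.inv_mul, h1] at hmul
  have key : ∀ a b : ℤ, (a = 1 ∨ a = -1) → (b = 1 ∨ b = -1) → 1 = a * b → (a = -1 ↔ b = -1) := by
    rintro a b (rfl | rfl) (rfl | rfl) h <;> omega
  exact key _ _ (placeSymbol_eq_one_or_eq_neg_one _ _ p) (placeSymbol_eq_one_or_eq_neg_one _ _ p) hmul

/-- **THE ROW INDEX IS THE `T`-SET: `[q] = [q'] ⟺ T(q) = T(q')`**, `T(q) = badPlaces q θ` the (finite) set of
places of `F`, finite or infinite, at which `(q, θ)_𝔭 = -1` — the census labels `W_{2k}.E.T` of §b03.5 are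
faithful on classes (`T(q⁻¹q') = T(q) ∆ T(q')`). [cite: Deligne1982HodgeCycles, §4 (1) and Prop. 4.1]
[cite: Omeara1963, §65D Thm. 65:23] -/
theorem mk_eq_mk_iff_badPlaces_eq (q q' : (realField R)ˣ) :
    (QuotientGroup.mk q : cmNormResidueGroup R) = QuotientGroup.mk q' ↔
      badPlaces (q : realField R) (AdjoinRoot.root (realPolyQ R)) =
        badPlaces (q' : realField R) (AdjoinRoot.root (realPolyQ R)) := by
  rw [mk_eq_mk_iff_hilbertSymbol_eq_one, hilbertSymbol_root_eq_one_iff_badPlaces_eq_empty (Units.ne_zero _),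
    Units.val_mul, badPlaces_mul (Units.ne_zero _) (Units.ne_zero _) root_realPolyQ_ne_zero, badPlaces_inv,
    Set.symmDiff_eq_empty]

/-- In particular `[q] = [(-1)^k]` (SPLIT, Deligne Cor. 4.2) iff `T(q) = T((-1)^k)`; for `k` even iff `T(q) = ∅`.
[cite: Deligne1982HodgeCycles, §4 Cor. 4.2] -/
theorem mk_eq_splitDiscriminantClassCM_iff_badPlaces_eq_empty (q : (realField R)ˣ) {k : ℕ} (hk : Even k) :
    (QuotientGroup.mk q : cmNormResidueGroup R) = splitDiscriminantClassCM R k ↔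
      badPlaces (q : realField R) (AdjoinRoot.root (realPolyQ R)) = ∅ := by
  rw [splitDiscriminantClassCM, hk.neg_one_pow, mk_eq_mk_iff_badPlaces_eq, Units.val_one]
  have h1 : badPlaces (1 : realField R) (AdjoinRoot.root (realPolyQ R)) = ∅ := by
    ext p
    simp only [mem_badPlaces_iff, Set.mem_empty_iff_false, iff_false]
    cases p with
    | inl v => rw [placeSymbol_inl, map_one, hilbertSymbol_one_left]; norm_num
    | inr w => rw [placeSymbol_inr, map_one, hilbertSymbol_one_left]; norm_num
  rw [h1]

end Summit.HodgeConjecture.HodgeConjecture.Ring2.WeilCoverageCM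

end
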